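import Mathlib
import HarnessLib
import Literature.MathematicalPhysics.StatisticalMechanics.TuningLipschitzTorusFRD
import Literature.MathematicalPhysics.StatisticalMechanics.RenormalisationMapKernelSubWeak
import Literature.MathematicalPhysics.StatisticalMechanics.StepOperatorBKernelSubScale

/-!
# Hypothesis (12.53) of [ABKM19] Lemma 12.6 for the torus steps: `S_k^{(q)}` is Lipschitz in the
# tuning parameter, GLOBALLY on the ball, with a volume-dependent constant

For ONE finite-range-decomposition package (clauses (o)–(v) of `GradientFRD.TorusFRD d`), the weight tower
of Theorem 7.1 for the `q = 0` kernels and the step-kernel families `𝒞s_q = (j ↦ 𝒞_{1+q,j})` of symmetric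
`q` in the ball `Σ|q_{ij}| ≤ T₀` (`T₀ ≤ ½`, `K T₀ ≤ log(1+θ)`, `θ < θ̄`), under the side conditions of
Theorem 6.8 (`RGStepABKMQ`), the irrelevant step `rgSQ 𝒞s_q k` satisfies

* **`exists_activityNormLE_rgSQ_sub_of_torusFRD`** — there is `l_T ≥ 0` (depending on the package, the
  volume and the norm parameters; NOT small) with
  `‖S^{(q)}_k(u,v) − S^{(q')}_k(u,v)‖_{k+1} ≤ l_T · Σ|q−q'| · max(‖u‖, ‖v‖_k)` for all `q, q'` in the
  ball, `k + 1 ≤ N`, `‖u‖ ≤ r`, `‖v‖_k ≤ c ≤ r` — verbatim the hypothesis `hl` of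
  `TunedInitialConditionTorusFRD.exists_tuned_initial_of_torusFRD`.

Locally (`Σ|q−q'| ≤ T₁`) this is `RenormalisationMapKernelSubWeak.weakNormLE_nextKStep_kernel_sub_abkm`
with the pair property of Lemma 8.4 (`ℓ = 1`, `tayNormLE_fluct_sub_fluct_pow_abkm`, `τ = e^{KΣ|q−q'|} − 1`),
`‖H̃_q − H̃_{q'}‖_{k,0}` from `hamNorm_nextH_sub_of_torusFRD` and the scale-`k` `B_k`-comparison; in the far
field the crude bound `‖S^{(q)}(u,v)‖ + ‖S^{(q')}(u,v)‖ ≤ 2σ(r)·max(‖u‖, c)` of Theorem 6.8 suffices.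
No contraction is extracted: Lemma 12.6 is used through Brouwer's theorem (`RGFlowStableManifoldBrouwer`),
so an `N`-dependent constant is enough.  Everything is proved; no named fact.

## References
* S. Adams, S. Buchholz, R. Kotecký, S. Müller, arXiv:1910.13564, Lemma 12.6 (12.53), Theorem 6.8,
  Lemma 8.4 [AdamsBuchholzKoteckyMuller2019].
* S. Buchholz, J. Funct. Anal. 275 (2018), Thm 2.4 [Buchholz2016].
-/

noncomputable section

namespace Literature.MathematicalPhysics.StatisticalMechanics.GradientRG

open scoped BigOperators
open Real Set Finset MeasureTheory
open Literature.MathematicalPhysics.StatisticalMechanics.GradientFRD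
  (fourierCoeff cExt cExt_of_mem IsElliptic IsUnitSymm InShell iterDiff supNorm conv ellOp isElliptic_one
    re_fourierCoeff_zero_of_sum_eq_zero)
open Literature.MathematicalPhysics.StatisticalMechanics.TorusPolymer
  (IsPolymer numBlocks blockOf boxCorner mem_blockOf_self isConn_blockOf)
open Literature.Barriers.CriticalPhenomena.LongRangePhi4.Polymer (IsConn)
open Literature.MathematicalPhysics.QuantumFieldTheory
open Literature.Dynamics.Hyperbolic

variable {d M : ℕ} [NeZero M]

section Package

variable {L N Mord R n ñ : ℕ} {θbar lam μ δ₁ δ₀ A𝒫 : ℝ}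
    {𝒞 : Matrix (Fin d) (Fin d) ℝ → ℕ → (Fin d → ZMod M) → ℝ} {Mc : ℕ → ℝ}
    {Cα : (Fin d → ℕ) → ℕ → ℝ} {c C : ℝ} {Cℓ : ℕ → ℝ}

set_option maxHeartbeats 1600000 in
/-- **Hypothesis (12.53) of [ABKM19] Lemma 12.6 for the torus steps, globally on the ball of tuning
parameters** (module docstring). [cite: AdamsBuchholzKoteckyMuller2019, Lemma 12.6 (12.53)] -/
theorem exists_activityNormLE_rgSQ_sub_of_torusFRD {h : ℝ} [Fact (0 < h)] [Fact (0 < L)]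
    (hd : 3 ≤ d) (hMord : 1 ≤ Mord) (hMR : Mord ≤ R) (hLodd : Odd L) (hL : 2 ^ (d + 3) + 16 * R ≤ L)
    (hR2 : 2 ≤ R) (hM : M = L ^ N)
    (hθbar : 0 < θbar) (hlam : 0 < lam) (hn : 2 * Mord ≤ n) (hn2 : 2 ≤ n) (hnñ : n ≤ ñ)
    (hc : 0 < c) (hC1 : 0 ≤ Cℓ 1)
    (hallA : ∀ A : Matrix (Fin d) (Fin d) ℝ, IsElliptic (1 / 2 : ℝ) 2 A →
        (∀ k, 1 ≤ k → k ≤ N + 1 →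
          ∑ x : Fin d → ZMod M, 𝒞 A k x = 0 ∧ ∀ x, 𝒞 A k (-x) = 𝒞 A k x) ∧
        (∀ k, 1 ≤ k → k ≤ N + 1 → ∀ φ : (Fin d → ZMod M) → ℝ, ∑ x, φ x = 0 →
          0 ≤ ∑ x, ∑ y, φ x * 𝒞 A k (x - y) * φ y) ∧
        (∀ φ : (Fin d → ZMod M) → ℝ, ∑ x, φ x = 0 →
          ellOp A (conv (fun x => ∑ k ∈ Finset.Icc 1 (N + 1), 𝒞 A k x) φ) = φ) ∧
        (∀ k, 1 ≤ k → k ≤ N → Mc k ≤ 0 ∧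
          ∀ x : Fin d → ZMod M, ((L : ℝ) ^ k) / 2 ≤ (supNorm x : ℝ) →
            𝒞 A k x = Mc k) ∧
        (∀ k, 1 ≤ k → k ≤ N + 1 → ∀ B : Matrix (Fin d) (Fin d) ℝ, IsUnitSymm B →
          (∃ ε : ℝ, 0 < ε ∧ ∀ x : Fin d → ZMod M,
            ContDiffOn ℝ ⊤ (fun s : ℝ => 𝒞 (A + s • B) k x) (Set.Ioo (-ε) ε)) ∧
          ∀ α : Fin d → ℕ, ∑ i, α i ≤ n → ∀ ℓ : ℕ, ∀ x : Fin d → ZMod M,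
            abs (iteratedDeriv ℓ (fun s : ℝ => iterDiff α (𝒞 (A + s • B) k) x) 0)
              ≤ Cα α ℓ / (L : ℝ) ^ ((k - 1) * (d - 2 + ∑ i, α i))) ∧
        (∀ k, 1 ≤ k → k ≤ N + 1 → ∀ j : ℕ, ∀ κ : Fin d → ZMod M, κ ≠ 0 → InShell L j κ →
          (j < k →
            c / (L : ℝ) ^ (2 * (d + ñ) + 1) * (L : ℝ) ^ (2 * j)
                / (L : ℝ) ^ ((k - j) * (d - 1 + n)) ≤ (fourierCoeff (𝒞 A k) κ).re ∧
            ‖fourierCoeff (𝒞 A k) κ‖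
              ≤ C * (L : ℝ) ^ (2 * (d + ñ) + 1) * (L : ℝ) ^ (2 * j)
                  / (L : ℝ) ^ ((k - j) * (d - 1 + n))) ∧
          (k ≤ j →
            c / (L : ℝ) ^ (2 * (d + ñ) + 1) * (L : ℝ) ^ (2 * k)
                ≤ (fourierCoeff (𝒞 A k) κ).re ∧
            ‖fourierCoeff (𝒞 A k) κ‖ ≤ C * (L : ℝ) ^ (2 * k)) ∧
          ∀ B : Matrix (Fin d) (Fin d) ℝ, IsUnitSymm B → ∀ ℓ : ℕ, 1 ≤ ℓ →
            (j < k →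
              ‖iteratedDeriv ℓ (fun s : ℝ => fourierCoeff (𝒞 (A + s • B) k) κ) 0‖
                ≤ Cℓ ℓ * (L : ℝ) ^ (2 * (d + ñ) + 1) * (L : ℝ) ^ (2 * j)
                    / (L : ℝ) ^ ((k - j) * (d - 1 + ñ))) ∧
            (k ≤ j →
              ‖iteratedDeriv ℓ (fun s : ℝ => fourierCoeff (𝒞 (A + s • B) k) κ) 0‖
                ≤ Cℓ ℓ * (L : ℝ) ^ (2 * k))))
    (hB : AbkmWeightBounds L N Mord R n θbar lam μ δ₁ δ₀ A𝒫 (fun j => 𝒞 1 j)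
      (abkmWeightData L N Mord R θbar (schedDelta δ₀ δ₁ N) fun j => 𝒞 1 j))
    {pT r₀ : ℕ} (hp : d / 2 + 2 ≤ pT) (hpM : pT + d ≤ Mord) (hr₀ : 3 ≤ r₀)
    (hδ₀ : 0 < δ₀) (hδ₁ : 0 < δ₁) (hh0 : hZeroSq d R δ₀ δ₁ ≤ h ^ 2)
    (hh2 : secondDiffConst (fun θ' => Cα θ' 0) ≤ h ^ 2)
    {θ : ℝ} (hθ0 : 0 ≤ θ) (hθ : θ < θbar)
    {T₀ : ℝ} (hT₀ : T₀ ≤ 1 / 2) (hKT₀ : shellRatioConst c (Cℓ 1) (L : ℝ) d ñ * T₀ ≤ Real.log (1 + θ))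
    {A𝒫' : ℝ} (hA𝒫' : weightIntConstRho θbar θ (traceConst d Mord R lam (derivSum d n fun θ' _ => Cα θ' 0)) = A𝒫')
    {A : ℝ} (hA1 : 1 ≤ A) (hA𝒫A : A𝒫' ≤ A)
    (hsmall : (2 : ℝ) ^ (L ^ d) * (A𝒫' * A ^ (-(1 - (1 + 1 / ((2 * (2 ^ d + 1) + 6 : ℝ) ^ d))⁻¹) : ℝ)) ≤ 1)
    {r : ℝ} (hr0 : 0 ≤ r) (hr : r ≤ 1 / 64)
    (hv : vABKM d R A A𝒫' r ≤ 1 / 64) (hωA : omegaABKM d R A A𝒫' r * A ^ 2 ≤ 1)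
    (hc3A : (kappaABKM d R A A𝒫' r) ^ (L ^ d) * ((2 * (2 * (kappaABKM d R A A𝒫' r) * max 1 A𝒫')) ^ ((2 ^ (d + 1) + 2) ^ d * L ^ d) * (4 : ℝ) ^ ((2 ^ (d + 1) + 2) ^ d * L ^ d)) ≤ A ^ ((1 + 1 / ((2 * (2 ^ d + 1) + 6 : ℝ) ^ d)) - 1 : ℝ))
    (hc2A : (kappaABKM d R A A𝒫' r) ^ (L ^ d) * ((2 * (kappaABKM d R A A𝒫' r) * max 1 A𝒫') ^ ((2 ^ (d + 1) + 2) ^ d * L ^ d) * (2 : ℝ) ^ ((2 ^ (d + 1) + 2) ^ d * L ^ d)) ≤ A ^ ((1 + 1 / ((2 * (2 ^ d + 1) + 6 : ℝ) ^ d)) - 1 : ℝ)) :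
    ∃ lT : ℝ, 0 ≤ lT ∧
      ∀ (q q' : Matrix (Fin d) (Fin d) ℝ), q.IsSymm → q'.IsSymm →
      ∑ i, ∑ j, |q i j| ≤ T₀ → ∑ i, ∑ j, |q' i j| ≤ T₀ → ∀ k, k + 1 ≤ N →
      ∀ (u : HamSpace ℂ d (fieldWt h (L : ℝ) d k) ((L : ℝ) ^ k) (L ^ (d * k)))
        (v : activitySpace (abkmNormParams L N Mord R pT r₀ h θbar A (schedDelta δ₀ δ₁ N) fun j => 𝒞 1 j) k)
        (cv : ℝ), ‖u‖ ≤ r →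
        activityNormLE (abkmNormParams L N Mord R pT r₀ h θbar A (schedDelta δ₀ δ₁ N) fun j => 𝒞 1 j) k v cv →
        cv ≤ r →
        activityNormLE (abkmNormParams L N Mord R pT r₀ h θbar A (schedDelta δ₀ δ₁ N) fun j => 𝒞 1 j) (k + 1)
          (rgSQ (L := L) (N := N) (Mord := Mord) (R := R) (p := pT) (r₀ := r₀) (h := h) (θbar := θbar) (A := A)
              (δ₀ := δ₀) (δ₁ := δ₁) (𝒞 := fun j => 𝒞 1 j) (fun j => 𝒞 ((1 : Matrix (Fin d) (Fin d) ℝ) + q) j) k u v -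
            rgSQ (L := L) (N := N) (Mord := Mord) (R := R) (p := pT) (r₀ := r₀) (h := h) (θbar := θbar) (A := A)
              (δ₀ := δ₀) (δ₁ := δ₁) (𝒞 := fun j => 𝒞 1 j) (fun j => 𝒞 ((1 : Matrix (Fin d) (Fin d) ℝ) + q') j) k u v)
          (lT * (∑ i, ∑ j, |(q - q') i j|) * max ‖u‖ cv) := by
  subst hA𝒫'
  have hh : 0 < h := Fact.out
  have hd2 : 2 ≤ d := by omega
  have h8 : 8 ≤ 2 ^ (d + 3) := by
    calc 8 = 2 ^ 3 := by norm_num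
      _ ≤ 2 ^ (d + 3) := Nat.pow_le_pow_right (by norm_num) (by omega)
  have hL2 : 2 ≤ L := by omega
  have hL0 : (0 : ℝ) ≤ (L : ℝ) := Nat.cast_nonneg _
  have hL0' : (0 : ℝ) < L := by exact_mod_cast hLodd.pos
  have hA0 : 0 < A := by linarith
  set P := abkmNormParams L N Mord R pT r₀ h θbar A (schedDelta δ₀ δ₁ N) fun j => 𝒞 1 j with hP
  have hPA : 0 < P.A := hA0
  set A𝒫θ := weightIntConstRho θbar θ (traceConst d Mord R lam (derivSum d n fun θ' _ => Cα θ' 0)) with hA𝒫θ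
  have hA𝒫θ0 : 0 ≤ A𝒫θ :=
    zero_le_one.trans (one_le_weightIntConstRho hθbar hθ0 hθ
      (traceConst_nonneg d Mord R hlam.le (derivSum_nonneg d n _)))
  set C87 := pi2BoundConst d (((2 * R + 2 : ℕ) : ℝ) + ((d / 2 + 1 : ℕ) : ℝ)) with hC87def
  have hC87 : 0 ≤ C87 := pi2BoundConst_nonneg d (by positivity)
  -- Hölder data and the local range (as in `TuningLipschitzTorusFRD`)
  set K := shellRatioConst c (Cℓ 1) (L : ℝ) d ñ with hKdef
  have hKsh0 : 0 ≤ K := shellRatioConst_nonneg hc hC1 hL0 d ñ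
  set ρ'' := (θ + θbar) / 2 with hρ''def
  have hρ''0 : 0 ≤ ρ'' := by rw [hρ''def]; linarith
  have hρ''θ : ρ'' < θbar := by rw [hρ''def]; linarith
  set p := (1 + ρ'') / (1 + θ) with hpdef
  have h1θ : 0 < 1 + θ := by linarith
  have hp1 : 1 < p := by rw [hpdef, one_lt_div h1θ]; rw [hρ''def]; linarith
  have hp0 : 0 ≤ p := by linarith
  set qH := Real.conjExponent p with hqHdef
  have hpq : p.HolderConjugate qH := Real.HolderConjugate.conjExponent hp1
  have hqH1 : 1 < qH := hpq.symm.lt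
  have hqH0 : 0 < qH := by linarith
  have hpρ : p * (1 + θ) ≤ 1 + ρ'' := by rw [hpdef, div_mul_cancel₀ _ h1θ.ne']
  set gcc := gaussCompConst (Fintype.card (Fin d → ZMod M)) qH with hgccdef
  have hgcc : 0 ≤ gcc := gaussCompConst_nonneg _ hqH0.le
  set A𝒫p := weightIntConstRho θbar ρ'' (traceConst d Mord R lam (derivSum d n fun θ' _ => Cα θ' 0)) with hA𝒫pdef
  have hA𝒫p : 0 ≤ A𝒫p :=
    zero_le_one.trans (one_le_weightIntConstRho hθbar hρ''0 hρ''θ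
      (traceConst_nonneg d Mord R hlam.le (derivSum_nonneg d n _)))
  set κp := A𝒫p ^ (1 / p) with hκpdef
  have hκp : 0 ≤ κp := Real.rpow_nonneg hA𝒫p _
  set T₁ := min 1 (1 / (16 * qH * ((K + 1) * Real.exp (2 * K)))) with hT₁def
  have hden : 0 < 16 * qH * ((K + 1) * Real.exp (2 * K)) := by positivity
  have hT₁0 : 0 < T₁ := lt_min zero_lt_one (div_pos one_pos hden)
  have hT₁1 : T₁ ≤ 1 := min_le_left _ _
  set ℓ₁ := (r₀ + 1 : ℝ) * gcc * (K * Real.exp (2 * K)) with hℓ₁def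
  have hℓ₁ : 0 ≤ ℓ₁ := by positivity
  set S'' := secondDiffConst (fun α => Cα α 1) with hS''
  have hS''0 : 0 ≤ S'' := secondDiffConst_nonneg _
  set 𝔅 : ℕ := Fintype.card (Fin d → ZMod M) with h𝔅
  set Γ : ℝ := ((2 : ℝ) ^ Fintype.card (Fin d → ZMod M)) ^ 3 * ((10 : ℝ) ^ Fintype.card (Fin d → ZMod M)) ^ 4 *
          (144 * (Fintype.card (Fin d → ZMod M) : ℝ) * (max 1 A𝒫θ) ^ Fintype.card (Fin d → ZMod M) +
            30 * (max 1 κp) ^ Fintype.card (Fin d → ZMod M)) with hΓ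
  have hΓ0 : 0 ≤ Γ := by positivity
  set Λloc := Γ * A ^ 𝔅 * (S'' / h ^ 2 + C87 * (ℓ₁ * κp * A⁻¹) + ℓ₁) with hΛloc
  have hΛloc0 : 0 ≤ Λloc := by positivity
  set σ := sigmaABKM d L R A A𝒫θ r with hσdef
  have hσ0 : 0 ≤ σ := sigmaABKM_nonneg hLodd.pos hA1 hA𝒫θ0 hr0
  -- the norm predicates and Theorem 6.8 for every `q` in the ball
  have hQ : RGFlow.IsSubaddNormBound (F := fun k => activitySpace P k) (activityNormLE P) :=
    isSubaddNormBound_activityNormLE P hPA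
  have hfam : ∀ {q : Matrix (Fin d) (Fin d) ℝ}, q.IsSymm → ∑ i, ∑ j, |q i j| ≤ T₀ → ∀ k, k + 1 ≤ N →
      StepKernelBounds (abkmWeightData L N Mord R θbar (schedDelta δ₀ δ₁ N) fun j => 𝒞 1 j) L k A𝒫θ
        (secondDiffConst fun θ' => Cα θ' 0) ((fun j => 𝒞 ((1 : Matrix (Fin d) (Fin d) ℝ) + q) j) (k + 1)) :=
    fun hq hqT => stepKernelBounds_family_of_torusFRD hd hMord hMR hLodd hL hθbar hlam hn hn2 hnñ hc hC1 hallA hB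
      hθ0 hθ hT₀ hKT₀ hq hqT
  have hT : ∀ {q : Matrix (Fin d) (Fin d) ℝ} (hq : q.IsSymm) (hqT : ∑ i, ∑ j, |q i j| ≤ T₀),
      RGFlow.IsRGStepQ (E := fun k => HamSpace ℂ d (fieldWt h (L : ℝ) d k) ((L : ℝ) ^ k) (L ^ (d * k)))
        (F := fun k => activitySpace P k) N r (3 / 4) ((L : ℝ) ^ d * (C87 * (A𝒫θ * A⁻¹))) σ (activityNormLE P)
        (rgA L h (fun j => 𝒞 ((1 : Matrix (Fin d) (Fin d) ℝ) + q) j))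
        (rgBQ (p := pT) (A := A) hB (by omega) hLodd hM (hfam hq hqT))
        (rgSQ (L := L) (N := N) (Mord := Mord) (R := R) (p := pT) (r₀ := r₀) (h := h) (θbar := θbar) (A := A)
          (δ₀ := δ₀) (δ₁ := δ₁) (𝒞 := fun j => 𝒞 1 j) (fun j => 𝒞 ((1 : Matrix (Fin d) (Fin d) ℝ) + q) j)) :=
    fun hq hqT => isRGStepQ_abkm_of_stepKernelBounds (p := pT) hd hLodd hL hR2 hM hp hpM hMR hr₀ hB hδ₀ hδ₁ hh hh0
      (hfam hq hqT) hh2 hA𝒫θ0 hA1 hA𝒫A hsmall hr0 hr hv hωA hc3A hc2A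
  refine ⟨max Λloc (2 * σ / T₁), le_max_of_le_left hΛloc0, ?_⟩
  intro q q' hq hq' hqT hq'T k hk u v cv hu hvv hcv
  set t := ∑ i, ∑ j, |(q - q') i j| with htdef
  have ht0 : 0 ≤ t := entrySum_nonneg _
  have hMt : M = P.L ^ k * L ^ (N - k) := by
    show M = L ^ k * L ^ (N - k)
    rw [hM, ← pow_add, Nat.add_sub_cancel' (by omega)]
  have hcv0 : 0 ≤ cv := nonneg_of_weakNormLE hPA hMt hLodd.pow hLodd.pow hvv
  have hmax0 : 0 ≤ max ‖u‖ cv := le_max_of_le_left (norm_nonneg _)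
  by_cases htT : t ≤ T₁
  · -- LOCAL: the two-kernel comparison
    have hq2 : ∑ i, ∑ j, |q i j| ≤ 1 / 2 := hqT.trans hT₀
    have hq'2 : ∑ i, ∑ j, |q' i j| ≤ 1 / 2 := hq'T.trans hT₀
    have hellq : IsElliptic (1 / 2 : ℝ) 2 ((1 : Matrix (Fin d) (Fin d) ℝ) + q) :=
      isElliptic_one_add_of_entrySum_le hq hq2
    have hellq' : IsElliptic (1 / 2 : ℝ) 2 ((1 : Matrix (Fin d) (Fin d) ℝ) + q') :=
      isElliptic_one_add_of_entrySum_le hq' hq'2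
    have hk1 : k + 1 ≤ N + 1 := by omega
    set 𝒞sa : ℕ → (Fin d → ZMod M) → ℝ := fun j => 𝒞 ((1 : Matrix (Fin d) (Fin d) ℝ) + q) j with h𝒞sa
    set 𝒞sb : ℕ → (Fin d → ZMod M) → ℝ := fun j => 𝒞 ((1 : Matrix (Fin d) (Fin d) ℝ) + q') j with h𝒞sb
    set Da := abkmStepData L R k 𝒞sa with hDa
    set Db := abkmStepData L R k 𝒞sb with hDb
    have hDa𝒞 : Da.𝒞 = 𝒞 ((1 : Matrix (Fin d) (Fin d) ℝ) + q) (k + 1) := rfl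
    have hDb𝒞 : Db.𝒞 = 𝒞 ((1 : Matrix (Fin d) (Fin d) ℝ) + q') (k + 1) := rfl
    have hSa := hfam hq hqT k hk
    have hSb := hfam hq' hq'T k hk
    -- the data `(H, K)`
    set H := HamSpace.toHam u with hHdef
    set Kf := mulExt ((v : activitySpace P k) : Finset (Fin d → ZMod M) → ((Fin d → ZMod M) → ℝ) → ℂ) with hKfdef
    have hHr : hamNorm (fieldWt h (L : ℝ) d k) ((L : ℝ) ^ k) (L ^ (d * k)) H ≤ r := by
      rw [hHdef, ← HamSpace.norm_def]; exact hu
    have hH64 : hamNorm (fieldWt h (L : ℝ) d k) ((L : ℝ) ^ k) (L ^ (d * k)) H ≤ 1 / 64 := hHr.trans hr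
    have hKw : WeakNormLE P k Kf cv := activitySpace.weakNormLE_mulExt v hvv
    have hKr : WeakNormLE P k Kf r := hKw.mono hPA hcv
    have hKd : ∀ Y, ContDiff ℝ r₀ (Kf Y) := activitySpace.contDiff_mulExt v
    have hk1L : 1 ≤ L ^ k := Nat.one_le_pow _ _ hLodd.pos
    have hKfac : Factorises (L ^ k) Kf := factorises_mulExt hk1L
    have hK0 : ∀ φ, Kf ∅ φ = 1 := fun φ => mulExt_empty φ
    have hKloc : ∀ Y, IsPolymer (L ^ k) Y → IsConn Y → IsGaugeLocal (P.gauge k Y) (Kf Y) :=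
      fun Y hY hYc => activitySpace.isGaugeLocal_mulExt v hY hYc
    have hKt : TransInv (L ^ k) Kf := activitySpace.transInv_mulExt v
    have hcv1 : cv ≤ 1 := hcv.trans (hr.trans (by norm_num))
    -- memberships of the two images
    have hmema : restrictConn (L ^ (k + 1)) (nextKStep Da H Kf) ∈ activitySpace P (k + 1) :=
      restrictConn_nextKStep_mem_activitySpace_of_stepKernelBounds hd hLodd hL hR2 hM hk hp hpM hMR hr₀ hB hδ₀ hδ₁ hh hh0
        hh2 hA𝒫θ0 hA1 hA𝒫A hsmall Da rfl rfl hSa rfl rfl hHr hr hKr hKfac hK0 hKd hKloc hKt hv hωA hc3A hc2A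
    have hmemb : restrictConn (L ^ (k + 1)) (nextKStep Db H Kf) ∈ activitySpace P (k + 1) :=
      restrictConn_nextKStep_mem_activitySpace_of_stepKernelBounds hd hLodd hL hR2 hM hk hp hpM hMR hr₀ hB hδ₀ hδ₁ hh hh0
        hh2 hA𝒫θ0 hA1 hA𝒫A hsmall Db rfl rfl hSb rfl rfl hHr hr hKr hKfac hK0 hKd hKloc hKt hv hωA hc3A hc2A
    -- the pair property (Lemma 8.4, ℓ = 1) with `τ = e^{Kt} − 1`
    set τ := Real.exp (K * t) - 1 with hτdef
    have hτ0 : 0 ≤ τ := exp_mul_sub_one_nonneg hKsh0 ht0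
    have hKT : K * t ≤ Real.log (1 + τ) := by rw [hτdef, log_one_add_exp_mul_sub_one]
    have hτle : τ * (1 + τ) ≤ K * Real.exp (2 * K) * t := by
      have h1 := exp_mul_sub_one_mul_le hKsh0 ht0 htT
      have he1 : Real.exp (2 * K * T₁) ≤ Real.exp (2 * K) := by
        apply Real.exp_le_exp.2
        calc 2 * K * T₁ ≤ 2 * K * 1 := mul_le_mul_of_nonneg_left hT₁1 (by positivity)
          _ = 2 * K := mul_one _
      exact h1.trans (mul_le_mul_of_nonneg_right (mul_le_mul_of_nonneg_left he1 hKsh0) ht0)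
    have hτq : τ * (1 + τ) ≤ 1 / (16 * qH) := by
      have h2 : K * Real.exp (2 * K) * t ≤ K * Real.exp (2 * K) * T₁ :=
        mul_le_mul_of_nonneg_left htT (by positivity)
      have h3 : K * Real.exp (2 * K) * T₁ ≤
          K * Real.exp (2 * K) * (1 / (16 * qH * ((K + 1) * Real.exp (2 * K)))) :=
        mul_le_mul_of_nonneg_left (min_le_right _ _) (by positivity)
      have h4 : K * Real.exp (2 * K) * (1 / (16 * qH * ((K + 1) * Real.exp (2 * K)))) ≤ 1 / (16 * qH) := by
        rw [mul_one_div, div_le_div_iff₀ hden (by positivity), one_mul]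
        have : K * Real.exp (2 * K) * (16 * qH) ≤ (K + 1) * Real.exp (2 * K) * (16 * qH) := by
          gcongr; linarith
        linarith
      linarith
    have hSp : StepKernelBounds (abkmWeightData L N Mord R θbar (schedDelta δ₀ δ₁ N) fun j => 𝒞 1 j) L k _ _
        (fun x => p * Db.𝒞 x) :=
      stepKernelBounds_const_mul_one_add_of_torusFRD hd hMord hMR hLodd hL hθbar hlam hn hn2 hnñ hc hC1
        hallA hB hk1 hθ0 hT₀ hKT₀ hq' hq'T hp0 hρ''0 hρ''θ hpρ
    have hoa := (hallA _ hellq).1 (k + 1) (by omega) hk1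
    have hob := (hallA _ hellq').1 (k + 1) (by omega) hk1
    have hposa : ∀ κ : Fin d → ZMod M, κ ≠ 0 → 0 < (fourierCoeff Da.𝒞 κ).re := fun κ hκ =>
      re_fourierCoeff_pos_of_torusFRD (hallA _ hellq).2.2.2.2.2 hc hL2 (by omega) hk1 hκ
    have hposb : ∀ κ : Fin d → ZMod M, κ ≠ 0 → 0 < (fourierCoeff Db.𝒞 κ).re := fun κ hκ =>
      re_fourierCoeff_pos_of_torusFRD (hallA _ hellq').2.2.2.2.2 hc hL2 (by omega) hk1 hκ
    have hcmp : ∀ κ, |(fourierCoeff Da.𝒞 κ).re - (fourierCoeff Db.𝒞 κ).re| ≤ τ * (1 + τ) * (fourierCoeff Da.𝒞 κ).re :=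
      abs_re_fourierCoeff_one_add_sub_le_of_torusFRD (fun A hA => (hallA A hA).1)
        (fun A hA => (hallA A hA).2.2.2.2.1) (fun A hA => (hallA A hA).2.2.2.2.2) hc hC1 hL2 hnñ hq' hq hq'2 hq2
        (k := k + 1) (by omega) hk1 hτ0 hKT
    have hδ0 : 0 ≤ τ * (1 + τ) := by positivity
    set ℓ := (r₀ + 1 : ℝ) * gcc * (τ * (1 + τ)) with hℓdef
    have hℓ0 : 0 ≤ ℓ := by positivity
    have hℓle : ℓ ≤ ℓ₁ * t := by
      rw [hℓdef, hℓ₁def]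
      calc (r₀ + 1 : ℝ) * gcc * (τ * (1 + τ)) ≤ (r₀ + 1 : ℝ) * gcc * (K * Real.exp (2 * K) * t) :=
            mul_le_mul_of_nonneg_left hτle (by positivity)
        _ = (r₀ + 1 : ℝ) * gcc * (K * Real.exp (2 * K)) * t := by ring
    have hdiff : ∀ X : Finset (Fin d → ZMod M), IsPolymer (L ^ k) X →
        ∀ (F : ((Fin d → ZMod M) → ℝ) → ℂ) (b : ℝ), 0 ≤ b → ContDiff ℝ r₀ F → IsGaugeLocal (P.gauge k X) F →
          TayNormLE (P.gauge k X) r₀ ((abkmWeightData L N Mord R θbar (schedDelta δ₀ δ₁ N) fun j => 𝒞 1 j).weight k X) F b →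
          TayNormLE (P.gauge k X) r₀ ((abkmWeightData L N Mord R θbar (schedDelta δ₀ δ₁ N) fun j => 𝒞 1 j).midWeight k X)
            (fluct (𝒞sa (k + 1)) F - fluct (𝒞sb (k + 1)) F) (b * ℓ * κp ^ numBlocks (L ^ k) X) :=
      fun X hX F b hb hFd hFloc hF =>
        tayNormLE_fluct_sub_fluct_pow_abkm (pT := pT) (h := h) (A := A) hB hSa hSb hpq hSp hA𝒫p hoa.2 hob.2 hoa.1 hob.1
          hposa hposb hδ0 hτq hcmp hX hb hFd hFloc hF
    -- `‖H̃_a − H̃_b‖_{k,0}`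
    have hopB : hamNorm (fieldWt h L d k) ((L : ℝ) ^ k) (L ^ (d * k)) (opB Da Kf - opB Db Kf) ≤
        C87 * (cv * ℓ * κp * A⁻¹) :=
      hamNorm_opB_sub_abkm_le_scale_of_stepKernelBounds hd hLodd hL hM hk hpM hMR hr₀ hB hh hA1 Da Db hSa hSb
        (x₀ := 0) rfl rfl rfl rfl (fun X hX _ => hdiff X hX) hcv0 hKw hKd hKloc
    have hnextH := hamNorm_nextH_sub_of_torusFRD hd hLodd hL hM hn2 hc hallA hk (p := pT) (by omega) (by omega) hh
      hq' hq hq'2 hq2 H Kf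
    set ℓH := S'' * t / h ^ 2 * hamNorm (fieldWt h (L : ℝ) d k) ((L : ℝ) ^ k) (L ^ (d * k)) H +
      C87 * (cv * ℓ * κp * A⁻¹) with hℓHdef
    have hHt : hamNorm (fieldWt h (L : ℝ) d k) ((L : ℝ) ^ k) (L ^ (d * k)) (nextH Da H Kf - nextH Db H Kf) ≤ ℓH := by
      rw [hℓHdef]
      exact hnextH.trans (add_le_add le_rfl hopB)
    -- C87 smallness for the two kernels (`v_r ≤ 1/64`, `cv ≤ r`)
    have hva : C87 * (cv * A𝒫θ * A⁻¹) ≤ 1 / 64 := by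
      have : C87 * (cv * A𝒫θ * A⁻¹) ≤ C87 * (r * A𝒫θ * A⁻¹) := by
        apply mul_le_mul_of_nonneg_left _ hC87
        exact mul_le_mul_of_nonneg_right (mul_le_mul_of_nonneg_right hcv hA𝒫θ0) (inv_nonneg.2 hA0.le)
      exact this.trans hv
    -- the weak-norm estimate of the difference of the two images
    have hW := weakNormLE_nextKStep_kernel_sub_abkm (p := pT) (r₀ := r₀) (A := A) hd hLodd hL hR2 hM hk hSa hSb
      (by omega) (by omega) (by omega) (by omega) hB hδ₀ hδ₁ hh hh0 hA𝒫θ0 hA1 hh2 hh2 hH64 hcv0 hcv1 hKw hKfac hK0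
      hKd hKloc hva hva hℓ0 hκp hdiff hHt
    -- rewrite the bundled difference
    show WeakNormLE P (k + 1)
      (((rgSQ (L := L) (N := N) (Mord := Mord) (R := R) (p := pT) (r₀ := r₀) (h := h) (θbar := θbar) (A := A)
          (δ₀ := δ₀) (δ₁ := δ₁) (𝒞 := fun j => 𝒞 1 j) 𝒞sa k u v -
        rgSQ (L := L) (N := N) (Mord := Mord) (R := R) (p := pT) (r₀ := r₀) (h := h) (θbar := θbar) (A := A)
          (δ₀ := δ₀) (δ₁ := δ₁) (𝒞 := fun j => 𝒞 1 j) 𝒞sb k u v : activitySpace P (k + 1)) :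
        Finset (Fin d → ZMod M) → ((Fin d → ZMod M) → ℝ) → ℂ)) _
    rw [Submodule.coe_sub, coe_rgSQ_of_mem hmema, coe_rgSQ_of_mem hmemb, ← restrictConn_sub]
    refine (weakNormLE_restrictConn_iff (P := P) (k := k + 1)).2 (hW.mono hPA ?_)
    -- the constant: `Γ A^𝔅 (ℓH + ℓ m) ≤ Λloc t m ≤ max Λloc (2σ/T₁) t m`
    have hnormu : hamNorm (fieldWt h (L : ℝ) d k) ((L : ℝ) ^ k) (L ^ (d * k)) H = ‖u‖ := by
      rw [HamSpace.norm_def]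
    rw [hnormu] at hℓHdef ⊢
    set m := max ‖u‖ cv with hm
    have hum : ‖u‖ ≤ m := le_max_left _ _
    have hcm : cv ≤ m := le_max_right _ _
    have h1 : ℓH ≤ (S'' / h ^ 2 + C87 * (ℓ₁ * κp * A⁻¹)) * t * m := by
      rw [hℓHdef]
      have e1 : S'' * t / h ^ 2 * ‖u‖ ≤ S'' / h ^ 2 * t * m := by
        rw [show S'' * t / h ^ 2 * ‖u‖ = S'' / h ^ 2 * t * ‖u‖ by ring]
        exact mul_le_mul_of_nonneg_left hum (by positivity)
      have e2 : C87 * (cv * ℓ * κp * A⁻¹) ≤ C87 * (m * (ℓ₁ * t) * κp * A⁻¹) := by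
        apply mul_le_mul_of_nonneg_left _ hC87
        have := mul_le_mul hcm hℓle hℓ0 (hcv0.trans hcm)
        exact mul_le_mul_of_nonneg_right (mul_le_mul_of_nonneg_right this hκp) (inv_nonneg.2 hA0.le)
      calc S'' * t / h ^ 2 * ‖u‖ + C87 * (cv * ℓ * κp * A⁻¹)
          ≤ S'' / h ^ 2 * t * m + C87 * (m * (ℓ₁ * t) * κp * A⁻¹) := add_le_add e1 e2
        _ = (S'' / h ^ 2 + C87 * (ℓ₁ * κp * A⁻¹)) * t * m := by ring
    have h2 : ℓ * m ≤ ℓ₁ * t * m := mul_le_mul_of_nonneg_right hℓle (hcv0.trans hcm)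
    have h3 : ℓH + ℓ * m ≤ (S'' / h ^ 2 + C87 * (ℓ₁ * κp * A⁻¹) + ℓ₁) * t * m := by
      calc ℓH + ℓ * m ≤ (S'' / h ^ 2 + C87 * (ℓ₁ * κp * A⁻¹)) * t * m + ℓ₁ * t * m := add_le_add h1 h2
        _ = (S'' / h ^ 2 + C87 * (ℓ₁ * κp * A⁻¹) + ℓ₁) * t * m := by ring
    calc Γ * A ^ 𝔅 * (ℓH + ℓ * m) ≤ Γ * A ^ 𝔅 * ((S'' / h ^ 2 + C87 * (ℓ₁ * κp * A⁻¹) + ℓ₁) * t * m) :=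
          mul_le_mul_of_nonneg_left h3 (by positivity)
      _ = Λloc * t * m := by rw [hΛloc]; ring
      _ ≤ max Λloc (2 * σ / T₁) * t * m :=
          mul_le_mul_of_nonneg_right (mul_le_mul_of_nonneg_right (le_max_left _ _) ht0) (hcv0.trans hcm)
  · -- FAR FIELD: Theorem 6.8 twice
    have htT' : T₁ < t := lt_of_not_ge htT
    have hzero : ∀ k, activityNormLE P k (0 : activitySpace P k) 0 := fun k => hQ.zero k
    have hSq : ∀ {q₀ : Matrix (Fin d) (Fin d) ℝ} (hq₀ : q₀.IsSymm) (hq₀T : ∑ i, ∑ j, |q₀ i j| ≤ T₀),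
        activityNormLE P (k + 1)
          (rgSQ (L := L) (N := N) (Mord := Mord) (R := R) (p := pT) (r₀ := r₀) (h := h) (θbar := θbar) (A := A)
            (δ₀ := δ₀) (δ₁ := δ₁) (𝒞 := fun j => 𝒞 1 j) (fun j => 𝒞 ((1 : Matrix (Fin d) (Fin d) ℝ) + q₀) j) k u v)
          (σ * max ‖u‖ cv) := by
      intro q₀ hq₀ hq₀T
      have hlip := (hT hq₀ hq₀T).lipschitz k (by omega) u 0 v 0 cv 0 cv hu (by rw [norm_zero]; exact hr0) hvv hcv
        (hzero k) hr0 (by rw [sub_zero]; exact hvv)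
      rw [(hT hq₀ hq₀T).map_zero k (by omega), sub_zero, sub_zero] at hlip
      exact hlip
    have hsub := hQ.sub (k + 1) _ _ _ _ (hSq hq hqT) (hSq hq' hq'T)
    refine hQ.mono (k + 1) _ _ _ hsub ?_
    have h1 : σ * max ‖u‖ cv + σ * max ‖u‖ cv = 2 * σ * max ‖u‖ cv := by ring
    rw [h1]
    have h2 : 2 * σ ≤ 2 * σ / T₁ * t := by
      rw [div_mul_eq_mul_div, le_div_iff₀ hT₁0]
      exact mul_le_mul_of_nonneg_left htT'.le (by positivity)
    calc 2 * σ * max ‖u‖ cv ≤ 2 * σ / T₁ * t * max ‖u‖ cv := mul_le_mul_of_nonneg_right h2 hmax0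
      _ ≤ max Λloc (2 * σ / T₁) * t * max ‖u‖ cv :=
          mul_le_mul_of_nonneg_right (mul_le_mul_of_nonneg_right (le_max_right _ _) ht0) hmax0

end Package

end Literature.MathematicalPhysics.StatisticalMechanics.GradientRG

end
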